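import Mathlib
import Literature.Analysis.FluidPDE.Tao2016AveragedNS.RestartedCascadeFlows
import HarnessLib

/-!
# `GappedFrontRobust`, tools for the (step)/(front) clauses: SLACK WEIGHTS AND ENVELOPES (helper for
  item stmt-NavierStokesRegularity-20423, crux K_B of routes TaoLadderRungThree / TaoLadderRungTwo /
  TaoLadderRungTwoPoly and its announced restatement over `GapData₂`)

HONEST FRAMING: elementary bookkeeping about the cell's slack envelope `TaoCascade.slackWeight` (Tao 2016,
§6.4 Lemma 6.7 / (4.10): the accumulated energy slack of a restarted flow) and one calculus identity; tree
module `RestartedCascadeFlows`. Nothing here is a statement about the Navier–Stokes equations, and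
nothing is asserted about any table.

CONTENTS (independent of the certificate format):
* `slackWeight_nonneg`, `slackWeight_mono_env`, `slackWeight_le_of_env_le` — sign, monotonicity in the
  envelope, and the bound `slackWeight L k ≤ c (1+ε₀)^{2k} E ∑_{d=1}^{L} (1+ε₀)^{(5/2+θ)d}` when
  `env(k+d) ≤ E` on the window `d ∈ [1, L]` (this is how the admissible slack `B₀ ≤ η·slackWeight` of
  `FrontExists` / `RobustStep` is converted into a pointwise bound);
* `weight_sq_mul_slackWeight_le`, `slackDecay_of_env_bound` — the SLACK-DECAY CRITERION: if
  `(1 + (1+ε₀)^{10j})² (1+ε₀)^{2j} env j ≤ A` for all `j` (bounded growth `(1+ε₀)^{2|j|}` behind the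
  front, decay faster than `(1+ε₀)^{-22j}` ahead), then for every `L` the (4.5)-weighted slack
  `(1 + (1+ε₀)^{10k}) √(slackWeight L k)` is bounded in `k` — the hypothesis `SlackDecay` under which
  `…InertPhantomFront.frontExists_of_gapData` delivers the (front) clause;
* `integral_exp_mul_le` — `∫₀ᵗ ψ₀ e^{K u} du ≤ ψ₀ e^{K t} / K` (`K > 0`, `ψ₀ ≥ 0`): with the
  profile `φ = ψ₀ e^{K·}` the row-sum term of `…Deviation.pseudoFlowOn_deviation_le` is `≤ (R/K) φ(t)`,
  which is how the exponential profile closes `bootstrap_family`.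
-/

noncomputable section

-- the sub-problem namespace `Summit.NavierStokesRegularity.NavierStokesRegularity` repeats the summit name by design (D-0017)
set_option linter.dupNamespace false

namespace Summit.NavierStokesRegularity.NavierStokesRegularity.Theorems

open Set MeasureTheory intervalIntegral Literature.Analysis.FluidPDE Literature.Analysis.FluidPDE.TaoCascade

namespace GappedFrontRobust

/-! ### Slack weights -/

/-- The slack weight is nonnegative for a nonnegative envelope and clock (`ε₀ > -1`).
[cite: Tao2016AveragedNS, §6.4 Lemma 6.7 (cumulative energy bound); cell vocabulary] -/
theorem slackWeight_nonneg {ε₀ θ c : ℝ} {env : ℤ → ℝ} (hε : 0 < 1 + ε₀) (hc : 0 ≤ c)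
    (henv : ∀ j, 0 ≤ env j) (L : ℕ) (k : ℤ) : 0 ≤ slackWeight ε₀ θ c env L k := by
  unfold slackWeight
  refine mul_nonneg (mul_nonneg hc (Real.rpow_pos_of_pos hε _).le) (Finset.sum_nonneg fun d _ => ?_)
  exact mul_nonneg (Real.rpow_pos_of_pos hε _).le (henv _)

/-- The slack weight is monotone in the envelope (`ε₀ > -1`, `c ≥ 0`).
[cite: Tao2016AveragedNS, §6.4 Lemma 6.7 (cumulative energy bound); cell vocabulary] -/
theorem slackWeight_mono_env {ε₀ θ c : ℝ} {env env' : ℤ → ℝ} (hε : 0 < 1 + ε₀) (hc : 0 ≤ c)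
    (hle : ∀ j, env j ≤ env' j) (L : ℕ) (k : ℤ) :
    slackWeight ε₀ θ c env L k ≤ slackWeight ε₀ θ c env' L k := by
  unfold slackWeight
  refine mul_le_mul_of_nonneg_left (Finset.sum_le_sum fun d _ => ?_)
    (mul_nonneg hc (Real.rpow_pos_of_pos hε _).le)
  exact mul_le_mul_of_nonneg_left (hle _) (Real.rpow_pos_of_pos hε _).le

/-- **Pointwise bound of the slack weight from a window bound on the envelope**: if `env (k+d) ≤ E` for
`d = 1, …, L` then `slackWeight L k ≤ c (1+ε₀)^{2k} E ∑_{d=1}^{L} (1+ε₀)^{(5/2+θ) d}` (`ε₀ > -1`,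
`c ≥ 0`). [cite: Tao2016AveragedNS, §6.4 Lemma 6.7 (cumulative energy bound); cell vocabulary] -/
theorem slackWeight_le_of_env_le {ε₀ θ c : ℝ} {env : ℤ → ℝ} (hε : 0 < 1 + ε₀) (hc : 0 ≤ c)
    (L : ℕ) (k : ℤ) {E : ℝ} (hE : ∀ d : ℕ, 1 ≤ d → d ≤ L → env (k + d) ≤ E) :
    slackWeight ε₀ θ c env L k ≤
      c * (1 + ε₀) ^ ((2 : ℝ) * k) * (E * ∑ d ∈ Finset.Icc 1 L, (1 + ε₀) ^ ((5 / 2 + θ) * (d : ℝ))) := by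
  unfold slackWeight
  refine mul_le_mul_of_nonneg_left ?_ (mul_nonneg hc (Real.rpow_pos_of_pos hε _).le)
  rw [Finset.mul_sum]
  refine Finset.sum_le_sum fun d hd => ?_
  rw [Finset.mem_Icc] at hd
  have h1 := hE d hd.1 hd.2
  have h2 : 0 ≤ (1 + ε₀) ^ ((5 / 2 + θ) * (d : ℝ)) := (Real.rpow_pos_of_pos hε _).le
  nlinarith

/-! ### The slack-decay criterion -/

/-- **Weighted slack bound**: if `(1 + (1+ε₀)^{10j})² (1+ε₀)^{2j} env j ≤ A` for every shell `j`
(`ε₀ ≥ 0`, `c ≥ 0`, `env ≥ 0`), then for all `L`, `k`: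
`(1 + (1+ε₀)^{10k})² · slackWeight L k ≤ c A ∑_{d=1}^{L} (1+ε₀)^{(5/2+θ) d}` — uniformly in `k`.
[cite: Tao2016AveragedNS, §4 (4.5) with §6.4 Lemma 6.7; cell vocabulary] -/
theorem weight_sq_mul_slackWeight_le {ε₀ θ c A : ℝ} {env : ℤ → ℝ} (hε : 0 ≤ ε₀) (hc : 0 ≤ c)
    (henv : ∀ j, 0 ≤ env j)
    (hA : ∀ j : ℤ, (1 + (1 + ε₀) ^ ((10 : ℝ) * j)) ^ 2 * (1 + ε₀) ^ ((2 : ℝ) * j) * env j ≤ A)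
    (L : ℕ) (k : ℤ) :
    (1 + (1 + ε₀) ^ ((10 : ℝ) * k)) ^ 2 * slackWeight ε₀ θ c env L k ≤
      c * A * ∑ d ∈ Finset.Icc 1 L, (1 + ε₀) ^ ((5 / 2 + θ) * (d : ℝ)) := by
  have hq : 0 < 1 + ε₀ := by linarith
  have hq1 : 1 ≤ 1 + ε₀ := by linarith
  -- per summand: (1+q^{10k})² q^{2k} env(k+d) ≤ A for d ≥ 0
  have hterm : ∀ d : ℕ, (1 + (1 + ε₀) ^ ((10 : ℝ) * k)) ^ 2 * (1 + ε₀) ^ ((2 : ℝ) * k) *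
      env (k + d) ≤ A := by
    intro d
    have hd0 : (0 : ℝ) ≤ d := Nat.cast_nonneg d
    have hkd : ((k + d : ℤ) : ℝ) = (k : ℝ) + d := by push_cast; ring
    -- monotonicity of the weight and of q^{2·} in the shell
    have hw : 1 + (1 + ε₀) ^ ((10 : ℝ) * k) ≤ 1 + (1 + ε₀) ^ ((10 : ℝ) * ((k + d : ℤ) : ℝ)) := by
      rw [hkd]
      have := Real.rpow_le_rpow_of_exponent_le hq1
        (show (10 : ℝ) * k ≤ (10 : ℝ) * ((k : ℝ) + d) by nlinarith)
      linarith
    have hw0 : 0 ≤ 1 + (1 + ε₀) ^ ((10 : ℝ) * k) := by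
      have := Real.rpow_pos_of_pos hq ((10 : ℝ) * k); linarith
    have h2 : (1 + ε₀) ^ ((2 : ℝ) * k) ≤ (1 + ε₀) ^ ((2 : ℝ) * ((k + d : ℤ) : ℝ)) := by
      rw [hkd]
      exact Real.rpow_le_rpow_of_exponent_le hq1 (by nlinarith)
    have h20 : 0 ≤ (1 + ε₀) ^ ((2 : ℝ) * k) := (Real.rpow_pos_of_pos hq _).le
    have hsq : (1 + (1 + ε₀) ^ ((10 : ℝ) * k)) ^ 2 ≤
        (1 + (1 + ε₀) ^ ((10 : ℝ) * ((k + d : ℤ) : ℝ))) ^ 2 := pow_le_pow_left₀ hw0 hw 2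
    calc (1 + (1 + ε₀) ^ ((10 : ℝ) * k)) ^ 2 * (1 + ε₀) ^ ((2 : ℝ) * k) * env (k + d)
        ≤ (1 + (1 + ε₀) ^ ((10 : ℝ) * ((k + d : ℤ) : ℝ))) ^ 2 *
            (1 + ε₀) ^ ((2 : ℝ) * ((k + d : ℤ) : ℝ)) * env (k + d) := by
          have := henv (k + d)
          gcongr
      _ ≤ A := hA (k + d)
  unfold slackWeight
  have hexp : ∀ d : ℕ, 0 ≤ (1 + ε₀) ^ ((5 / 2 + θ) * (d : ℝ)) := fun d =>
    (Real.rpow_pos_of_pos hq _).le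
  calc (1 + (1 + ε₀) ^ ((10 : ℝ) * k)) ^ 2 * (c * (1 + ε₀) ^ ((2 : ℝ) * k) *
          ∑ d ∈ Finset.Icc 1 L, (1 + ε₀) ^ ((5 / 2 + θ) * (d : ℝ)) * env (k + d))
      = c * ∑ d ∈ Finset.Icc 1 L, (1 + ε₀) ^ ((5 / 2 + θ) * (d : ℝ)) *
          ((1 + (1 + ε₀) ^ ((10 : ℝ) * k)) ^ 2 * (1 + ε₀) ^ ((2 : ℝ) * k) * env (k + d)) := by
        rw [Finset.mul_sum, Finset.mul_sum, Finset.mul_sum]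
        refine Finset.sum_congr rfl fun d _ => ?_
        ring
    _ ≤ c * ∑ d ∈ Finset.Icc 1 L, (1 + ε₀) ^ ((5 / 2 + θ) * (d : ℝ)) * A := by
        refine mul_le_mul_of_nonneg_left (Finset.sum_le_sum fun d _ => ?_) hc
        exact mul_le_mul_of_nonneg_left (hterm d) (hexp d)
    _ = c * A * ∑ d ∈ Finset.Icc 1 L, (1 + ε₀) ^ ((5 / 2 + θ) * (d : ℝ)) := by
        rw [← Finset.sum_mul]
        ring

/-- **SLACK-DECAY CRITERION.** If `(1 + (1+ε₀)^{10j})² (1+ε₀)^{2j} env j ≤ A` for every shell `j`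
(`ε₀ ≥ 0`, `c ≥ 0`, `env ≥ 0`), then for every number `L` of past epochs the (4.5)-weighted slack is
bounded in the shell: `∃ C, ∀ k, (1 + (1+ε₀)^{10k}) √(slackWeight L k) ≤ C` — the hypothesis
(`SlackDecay`) under which `frontExists_of_gapData` gives the (front) clause. Envelopes growing like
`(1+ε₀)^{2|j|}` behind the front and decaying super-geometrically ahead of it satisfy the criterion.
[cite: Tao2016AveragedNS, §4 (4.5) with §6.4 Lemma 6.7; cell vocabulary] -/
theorem slackDecay_of_env_bound {ε₀ θ c A : ℝ} {env : ℤ → ℝ} (hε : 0 ≤ ε₀) (hc : 0 ≤ c)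
    (henv : ∀ j, 0 ≤ env j)
    (hA : ∀ j : ℤ, (1 + (1 + ε₀) ^ ((10 : ℝ) * j)) ^ 2 * (1 + ε₀) ^ ((2 : ℝ) * j) * env j ≤ A) :
    ∀ L : ℕ, ∃ C : ℝ, ∀ k : ℤ,
      (1 + (1 + ε₀) ^ ((10 : ℝ) * k)) * Real.sqrt (slackWeight ε₀ θ c env L k) ≤ C := by
  have hq : 0 < 1 + ε₀ := by linarith
  intro L
  refine ⟨Real.sqrt (c * A * ∑ d ∈ Finset.Icc 1 L, (1 + ε₀) ^ ((5 / 2 + θ) * (d : ℝ))),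
    fun k => ?_⟩
  have hw0 : 0 ≤ 1 + (1 + ε₀) ^ ((10 : ℝ) * k) := by
    have := Real.rpow_pos_of_pos hq ((10 : ℝ) * k); linarith
  have h1 := weight_sq_mul_slackWeight_le (θ := θ) hε hc henv hA L k
  calc (1 + (1 + ε₀) ^ ((10 : ℝ) * k)) * Real.sqrt (slackWeight ε₀ θ c env L k)
      = Real.sqrt ((1 + (1 + ε₀) ^ ((10 : ℝ) * k)) ^ 2 * slackWeight ε₀ θ c env L k) := by
        rw [Real.sqrt_mul (sq_nonneg _), Real.sqrt_sq hw0]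
    _ ≤ Real.sqrt (c * A * ∑ d ∈ Finset.Icc 1 L, (1 + ε₀) ^ ((5 / 2 + θ) * (d : ℝ))) :=
        Real.sqrt_le_sqrt h1

/-! ### The exponential profile -/

/-- `∫₀ᵗ ψ₀ e^{K u} du ≤ ψ₀ e^{K t} / K` for `K > 0`, `ψ₀ ≥ 0` and every real `t` (indeed `= ψ₀ (e^{Kt} − 1)/K`).
[folklore] -/
theorem integral_exp_mul_le {ψ₀ K t : ℝ} (hK : 0 < K) (hψ : 0 ≤ ψ₀) :
    ∫ u in (0 : ℝ)..t, ψ₀ * Real.exp (K * u) ≤ ψ₀ * Real.exp (K * t) / K := by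
  have hderiv : ∀ u ∈ uIcc 0 t,
      HasDerivAt (fun u => ψ₀ * Real.exp (K * u) / K) (ψ₀ * Real.exp (K * u)) u := by
    intro u _
    have h1 : HasDerivAt (fun u => K * u) K u := by
      simpa using (hasDerivAt_id u).const_mul K
    have h2 : HasDerivAt (fun u => Real.exp (K * u)) (Real.exp (K * u) * K) u :=
      (Real.hasDerivAt_exp (K * u)).comp u h1
    have h3 := (h2.const_mul ψ₀).div_const K
    refine h3.congr_deriv ?_
    field_simp
  have hcont : Continuous fun u => ψ₀ * Real.exp (K * u) :=
    continuous_const.mul (Real.continuous_exp.comp (continuous_const.mul continuous_id))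
  have hftc := intervalIntegral.integral_eq_sub_of_hasDerivAt hderiv (hcont.intervalIntegrable 0 t)
  rw [hftc]
  simp only [mul_zero, Real.exp_zero, mul_one]
  have : 0 ≤ ψ₀ / K := div_nonneg hψ hK.le
  linarith

/-! ### Super-geometric weights dominate every exponential (appended by p1 g9) -/

/-- **(T1) makes the weights dominate every exponential.** If `q ≥ 1`, the weights are positive and
satisfy the tail growth clause `2 q^k w k ≤ w (k+1)` for `k ≥ k₁` ((T1) of `TailFat` / `TailCompat`),
then for every rate `a ≥ 0` there are a shell `J` and a constant `A > 0` with `q^{a j} ≤ A · w j` for all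
`j ≥ J` (induction from `J = max k₁ ⌈a⌉`: `q^{a(j+1)} = q^a q^{aj} ≤ 2 q^j · A w j ≤ A w (j+1)`). This is
the form in which the tail clauses feed the slack-decay criterion, the vanishing of the top-boundary
forcing `Λ_k r / w_k`, and the smallness of the tail start energies.
[cite: Tao2016AveragedNS, §6.2 Prop. 6.3 (ix) (super-geometric energy estimates ahead of the front); cell vocabulary] -/
theorem rpow_le_mul_weight_of_T1 {q : ℝ} {w : ℤ → ℝ} {k₁ : ℤ} (hq : 1 ≤ q) (hw : ∀ k, 0 < w k)
    (hT1 : ∀ k : ℤ, k₁ ≤ k → 2 * q ^ (k : ℝ) * w k ≤ w (k + 1)) (a : ℝ) :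
    ∃ (J : ℤ) (A : ℝ), 0 < A ∧ ∀ j : ℤ, J ≤ j → q ^ (a * j) ≤ A * w j := by
  have hq0 : 0 < q := by linarith
  set J : ℤ := max k₁ ⌈a⌉ with hJ
  have hJk : k₁ ≤ J := le_max_left _ _
  have hJa : a ≤ (J : ℝ) := le_trans (Int.le_ceil a) (by exact_mod_cast le_max_right k₁ ⌈a⌉)
  set A : ℝ := q ^ (a * J) / w J with hA
  have hApos : 0 < A := div_pos (Real.rpow_pos_of_pos hq0 _) (hw J)
  refine ⟨J, A, hApos, ?_⟩
  -- induction on the distance to J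
  have key : ∀ n : ℕ, q ^ (a * ((J + n : ℤ) : ℝ)) ≤ A * w (J + n) := by
    intro n
    induction n with
    | zero =>
      simp only [Nat.cast_zero, add_zero]
      rw [hA, div_mul_cancel₀ _ (hw J).ne']
    | succ n ih =>
      set j : ℤ := J + n with hj
      have hjJ : J ≤ j := by rw [hj]; linarith
      have hja : a ≤ (j : ℝ) := hJa.trans (by exact_mod_cast hjJ)
      have heq : (J + ((n + 1 : ℕ) : ℤ) : ℤ) = j + 1 := by rw [hj]; push_cast; ring
      rw [heq]
      -- q^{a(j+1)} = q^a · q^{aj}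
      have hsplit : q ^ (a * ((j + 1 : ℤ) : ℝ)) = q ^ a * q ^ (a * j) := by
        push_cast
        rw [show a * ((j : ℝ) + 1) = a + a * j by ring, Real.rpow_add hq0]
      -- q^a ≤ q^j ≤ 2 q^j
      have hqa : q ^ a ≤ 2 * q ^ (j : ℝ) := by
        have h1 : q ^ a ≤ q ^ (j : ℝ) := Real.rpow_le_rpow_of_exponent_le hq hja
        have h2 : 0 ≤ q ^ (j : ℝ) := (Real.rpow_pos_of_pos hq0 _).le
        linarith
      have hstep := hT1 j (hJk.trans hjJ)
      calc q ^ (a * ((j + 1 : ℤ) : ℝ)) = q ^ a * q ^ (a * j) := hsplit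
        _ ≤ (2 * q ^ (j : ℝ)) * (A * w j) :=
            mul_le_mul hqa ih (Real.rpow_pos_of_pos hq0 _).le (by positivity)
        _ = A * (2 * q ^ (j : ℝ) * w j) := by ring
        _ ≤ A * w (j + 1) := mul_le_mul_of_nonneg_left hstep hApos.le
  intro j hj
  obtain ⟨n, hn⟩ := Int.eq_ofNat_of_zero_le (show 0 ≤ j - J by linarith)
  have hj' : j = J + (n : ℤ) := by linarith
  rw [hj']
  exact key n

end GappedFrontRobust

end Summit.NavierStokesRegularity.NavierStokesRegularity.Theorems

end
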